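import Mathlib

/-!
# Tier7/Line3/HeckeWindowCounts — the §3b lattice counts in the §2c split model, I: the model and the cosets
(REPAIR-CENSUS §C U1; part II = Tier7/Line3/HeckeWindowSums.lean: the orbital sums and the window polynomial)

Filer: t7-L1-p3 (gen 6, prover-pub-hodge-repro2-t7-L1-p3-g6-0), assignment = the t7-lead's l. 15499 (U1 → this seat),
TARGET line STATUS l. 15509 (one module announced; split into I/II by the gate's 400-line rule, same content). Lane: Line 3
SUPPORT, [M]-level (a kernel fact about the MODEL that the dictionary then quotes); NOT a line, NOT a device; touches
neither residual clause (a′) nor (b′) of the line.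

WHAT IT SUPPLIES (L3-ARGUMENT.md v18 §2c «the split-place unramified double-torus orbital integral» and §3b «a Hecke
window at a split auxiliary place»; REPAIR-CENSUS §B3.2 (c) / §C U1 «the lattice counts `O_{γ₀}(1_{K ϖ^λ K})`,
`λ = (1,0), (1,1)`, in the §2c model — finite and explicit; not written out»). Everything is stated in the VALUATION
MODEL of §2c: at a split place `v`, `U(W_A)(F_v) ≅ GL₂(F_v)`, `T_A(F_v)` = the diagonal torus `T`, `K_v = GL₂(O_v)`,
`T_B(F_v) = h T h⁻¹` with `h ∈ K_v`, and after the substitution `t′ = h s h⁻¹` the integrand is `f(t⁻¹ γ s)` with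
`γ = γ₀ h = (a b; c d)`, `t = diag(t₁,t₂)`, `s = diag(s₁,s₂)`, where `a, b, c, d, ad − bc` are UNITS (regularity of
`γ₀`, all `v` outside the finite set `S`). Write `u, m, x, y` for the valuations of `t₁, t₂, s₁, s₂`.

* (K1) THE MODEL. `diag_inv_mul_mul_diag`: `t⁻¹ γ s = (a s₁/t₁, b s₂/t₁; c s₁/t₂, d s₂/t₂)` and
  `det (t⁻¹ γ s) = det γ · s₁ s₂ / (t₁ t₂)` — matrix identities over any field (`diag_inv` records that
  `diag(t₁⁻¹,t₂⁻¹)` IS `diag(t₁,t₂)⁻¹`). `AddVal` = an additive valuation restricted to the non-zero elements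
  (`v (x y) = v x + v y`, `v 1 = 0`); `entryVal_*` / `detVal_*`: with unit `a, b, c, d, ad − bc` the four entries of
  `t⁻¹ γ s` have valuations `x − u, y − u, x − m, y − m` and the determinant `x + y − u − m` — this is the
  bookkeeping of §2c verbatim. `InCartan l₁ l₂ u m x y` := «minimum entry valuation `= l₂` ∧ determinant valuation
  `= l₁ + l₂`» is the model's DEFINITION of `t⁻¹ γ s ∈ K ϖ^{(l₁,l₂)} K` (`l₁ ≥ l₂`; the Cartan decomposition /
  elementary divisors of `M₂(O_v)`: the ideal generated by the entries and the determinant are the two invariants of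
  a double coset — print, not re-proved here). `inCartan_shift`: invariance under the diagonal centre `Z^Δ`
  (`(u,m,x,y) ↦ (u+k,m+k,x+k,y+k)`) — so the normalisation `u = 0` of §2c is legitimate; `inCartan_translate`:
  `K ϖ^{(l₁,l₂)} K = ϖ^{l₂} · K ϖ^{(l₁−l₂,0)} K`.
* (K2) THE SOLUTION SETS (`u = 0`): `sol 0 0 = {(0,0,0)}` (§2c's «single coset `T(O) × T(O)` modulo `Z^Δ(O)`»);
  `sol 1 0 = {(0,0,1), (0,1,0), (1,1,1), (−1,0,0)}` (four cosets meet `K diag(ϖ,1) K`); `sol 1 1 = {(0,1,1)}`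
  (`ϖ K`: one coset); `sol 2 0` (eight cosets) and `sol 2 1` (four) for the cubic variant of §3b; the GENERAL
  `inCartan_n_zero`: `sol n 0 = {(m,m,n), (m,n,m) : 0 ≤ m ≤ n} ∪ {(m,0,m+n), (m,m+n,0) : −n ≤ m < 0}` (`4n` points
  for `n ≥ 1` — in words; the counts `1, 4, 1, 4, 8` for `λ = (0,0), (1,0), (1,1), (2,1), (2,0)` are kernel:
  `ncard_sol_*`).
Part II (`HeckeWindowSums`) turns these into the orbital sums `O_γ(1_{K ϖ^λ K}) / vol` for an unramified character
trivial on `Z^Δ`, the measure bridge, and the window polynomial `β₁ β₂ − c κ (β₁ + β₂ + α₁⁻¹ + α₂⁻¹) + c²`.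

NOT in this file: that the real `U(W_A)(F_v)`, `T_A`, `T_B`, `K_v`, `γ₀ h` ARE the model's objects (the dictionary,
(a′)); the Cartan decomposition itself (print); anything about `X`; nothing about the step (P) is claimed.

§8(d) (uses an L-value-free non-vanishing device): NO — elementary arithmetic of valuations.
-/

namespace Summit.Ventures.HodgeRepro2.Tier7.Line3.HeckeWindow

/-! ## K1. The valuation model of the diagonal–diagonal double coset -/

section MatrixIdentity

open Matrix

variable {F : Type*} [Field F]

/-- (K1) `diag(t₁⁻¹, t₂⁻¹)` is the inverse of `diag(t₁, t₂)` (for `t₁ t₂ ≠ 0`). -/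
theorem diag_inv (t₁ t₂ : F) (ht₁ : t₁ ≠ 0) (ht₂ : t₂ ≠ 0) :
    (diagonal ![t₁, t₂])⁻¹ = diagonal ![t₁⁻¹, t₂⁻¹] := by
  apply Matrix.inv_eq_right_inv
  rw [diagonal_mul_diagonal]
  ext i j
  fin_cases i <;> fin_cases j <;> simp [ht₁, ht₂]

/-- (K1) `t⁻¹ γ s = (a s₁/t₁, b s₂/t₁; c s₁/t₂, d s₂/t₂)` for `t = diag(t₁,t₂)`, `s = diag(s₁,s₂)`,
`γ = (a b; c d)` — the matrix of §2c. -/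
theorem diag_inv_mul_mul_diag (t₁ t₂ s₁ s₂ a b c d : F) :
    diagonal ![t₁⁻¹, t₂⁻¹] * !![a, b; c, d] * diagonal ![s₁, s₂] =
      !![a * s₁ / t₁, b * s₂ / t₁; c * s₁ / t₂, d * s₂ / t₂] := by
  ext i j
  simp only [mul_diagonal, diagonal_mul]
  fin_cases i <;> fin_cases j <;> simp <;> ring

/-- (K1) `det (t⁻¹ γ s) = det γ · s₁ s₂ / (t₁ t₂)`. -/
theorem det_diag_inv_mul_mul_diag (t₁ t₂ s₁ s₂ a b c d : F) :
    det (diagonal ![t₁⁻¹, t₂⁻¹] * !![a, b; c, d] * diagonal ![s₁, s₂]) =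
      (a * d - b * c) * (s₁ * s₂) / (t₁ * t₂) := by
  rw [det_mul, det_mul, det_diagonal, det_diagonal, det_fin_two_of]
  simp only [Fin.prod_univ_two, Matrix.cons_val_zero, Matrix.cons_val_one]
  ring

end MatrixIdentity

/-- (K1) An additive valuation of a field, restricted to the non-zero elements: `v (x * y) = v x + v y` for
`x, y ≠ 0` and `v 1 = 0` (the value at `0` is irrelevant and never used). -/
structure AddVal (F : Type*) [Field F] where
  /-- the valuation -/
  v : F → ℤ
  /-- multiplicativity on non-zero elements -/
  map_mul : ∀ x y : F, x ≠ 0 → y ≠ 0 → v (x * y) = v x + v y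
  /-- normalisation -/
  map_one : v 1 = 0

namespace AddVal

variable {F : Type*} [Field F] (V : AddVal F)

/-- `v x⁻¹ = − v x` for `x ≠ 0`. -/
theorem map_inv (x : F) (hx : x ≠ 0) : V.v x⁻¹ = - V.v x := by
  have h := V.map_mul x x⁻¹ hx (inv_ne_zero hx)
  rw [mul_inv_cancel₀ hx, V.map_one] at h
  linarith

/-- `v (x / y) = v x − v y` for `x, y ≠ 0`. -/
theorem map_div (x y : F) (hx : x ≠ 0) (hy : y ≠ 0) : V.v (x / y) = V.v x - V.v y := by
  rw [div_eq_mul_inv, V.map_mul x y⁻¹ hx (inv_ne_zero hy), V.map_inv y hy]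
  ring

/-- `v (a * s / t) = v s − v t` when `a` is a unit (`v a = 0`). -/
theorem map_unit_mul_div (a s t : F) (ha0 : a ≠ 0) (ha : V.v a = 0) (hs : s ≠ 0) (ht : t ≠ 0) :
    V.v (a * s / t) = V.v s - V.v t := by
  rw [V.map_div _ _ (mul_ne_zero ha0 hs) ht, V.map_mul _ _ ha0 hs, ha]
  ring

end AddVal

section EntryValuations

open Matrix

variable {F : Type*} [Field F] (V : AddVal F)

/-- (K1) The entries of `t⁻¹ γ s` with unit `a, b, c, d` have valuations `x − u, y − u, x − m, y − m`
(`u, m, x, y` = the valuations of `t₁, t₂, s₁, s₂`). -/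
theorem entryVal_diag_inv_mul_mul_diag (t₁ t₂ s₁ s₂ a b c d : F)
    (ht₁ : t₁ ≠ 0) (ht₂ : t₂ ≠ 0) (hs₁ : s₁ ≠ 0) (hs₂ : s₂ ≠ 0)
    (ha0 : a ≠ 0) (hb0 : b ≠ 0) (hc0 : c ≠ 0) (hd0 : d ≠ 0)
    (ha : V.v a = 0) (hb : V.v b = 0) (hc : V.v c = 0) (hd : V.v d = 0) :
    let g := diagonal ![t₁⁻¹, t₂⁻¹] * !![a, b; c, d] * diagonal ![s₁, s₂]
    V.v (g 0 0) = V.v s₁ - V.v t₁ ∧ V.v (g 0 1) = V.v s₂ - V.v t₁ ∧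
      V.v (g 1 0) = V.v s₁ - V.v t₂ ∧ V.v (g 1 1) = V.v s₂ - V.v t₂ := by
  intro g
  have hg : g = !![a * s₁ / t₁, b * s₂ / t₁; c * s₁ / t₂, d * s₂ / t₂] :=
    diag_inv_mul_mul_diag t₁ t₂ s₁ s₂ a b c d
  rw [hg]
  simp only [Matrix.of_apply, Matrix.cons_val', Matrix.cons_val_zero, Matrix.cons_val_one,
    Matrix.empty_val', Matrix.cons_val_fin_one]
  exact ⟨V.map_unit_mul_div a s₁ t₁ ha0 ha hs₁ ht₁, V.map_unit_mul_div b s₂ t₁ hb0 hb hs₂ ht₁,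
    V.map_unit_mul_div c s₁ t₂ hc0 hc hs₁ ht₂, V.map_unit_mul_div d s₂ t₂ hd0 hd hs₂ ht₂⟩

/-- (K1) The determinant of `t⁻¹ γ s` with `ad − bc` a unit has valuation `x + y − u − m`. -/
theorem detVal_diag_inv_mul_mul_diag (t₁ t₂ s₁ s₂ a b c d : F)
    (ht₁ : t₁ ≠ 0) (ht₂ : t₂ ≠ 0) (hs₁ : s₁ ≠ 0) (hs₂ : s₂ ≠ 0)
    (hΔ0 : a * d - b * c ≠ 0) (hΔ : V.v (a * d - b * c) = 0) :
    V.v (det (diagonal ![t₁⁻¹, t₂⁻¹] * !![a, b; c, d] * diagonal ![s₁, s₂])) =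
      V.v s₁ + V.v s₂ - V.v t₁ - V.v t₂ := by
  rw [det_diag_inv_mul_mul_diag, V.map_div _ _ (mul_ne_zero hΔ0 (mul_ne_zero hs₁ hs₂))
    (mul_ne_zero ht₁ ht₂), V.map_mul _ _ hΔ0 (mul_ne_zero hs₁ hs₂), V.map_mul _ _ hs₁ hs₂,
    V.map_mul _ _ ht₁ ht₂, hΔ]
  ring

end EntryValuations

/-! ### The Cartan model -/

/-- (K1) The minimum entry valuation of `t⁻¹ γ s` (unit `a, b, c, d`): `min (x−u) (y−u) (x−m) (y−m)`. -/
def minEntryVal (u m x y : ℤ) : ℤ := min (min (x - u) (y - u)) (min (x - m) (y - m))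

/-- (K1) The determinant valuation of `t⁻¹ γ s` (unit `ad − bc`): `x + y − u − m`. -/
def detVal (u m x y : ℤ) : ℤ := x + y - u - m

/-- (K1) THE MODEL: `t⁻¹ γ s ∈ K ϖ^{(l₁,l₂)} K` iff the minimum entry valuation is `l₂` and the determinant
valuation is `l₁ + l₂` (Cartan decomposition of `GL₂` over the valuation ring; `l₁ ≥ l₂`). -/
def InCartan (l₁ l₂ u m x y : ℤ) : Prop := minEntryVal u m x y = l₂ ∧ detVal u m x y = l₁ + l₂

/-- `min (x−u, y−u, x−m, y−m) = min x y − max u m`. -/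
theorem minEntryVal_eq (u m x y : ℤ) : minEntryVal u m x y = min x y - max u m := by
  unfold minEntryVal; omega

/-- (K1) Invariance under the diagonal centre `Z^Δ`: `(t, s) ↦ (z t, z s)`. -/
theorem inCartan_shift (l₁ l₂ u m x y k : ℤ) :
    InCartan l₁ l₂ (u + k) (m + k) (x + k) (y + k) ↔ InCartan l₁ l₂ u m x y := by
  unfold InCartan minEntryVal detVal; omega

/-- (K1) Normalising `t₁ = 1`: every coset has a representative with `u = 0`. -/
theorem inCartan_iff_normalised (l₁ l₂ u m x y : ℤ) :
    InCartan l₁ l₂ u m x y ↔ InCartan l₁ l₂ 0 (m - u) (x - u) (y - u) := by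
  unfold InCartan minEntryVal detVal; omega

/-- (K1) Central translate: `K ϖ^{(l₁,l₂)} K = ϖ^{l₂} · K ϖ^{(l₁−l₂,0)} K` (`s ↦ ϖ^{l₂} s`). -/
theorem inCartan_translate (l₁ l₂ u m x y : ℤ) :
    InCartan l₁ l₂ u m x y ↔ InCartan (l₁ - l₂) 0 u m (x - l₂) (y - l₂) := by
  unfold InCartan minEntryVal detVal; omega

/-! ## K2. The solution sets (`u = 0` normalised) -/

/-- (K2) `λ = (0,0)`: the single coset `T(O) × T(O)` modulo `Z^Δ(O)` (§2c). -/
theorem inCartan_zero_zero (m x y : ℤ) : InCartan 0 0 0 m x y ↔ m = 0 ∧ x = 0 ∧ y = 0 := by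
  unfold InCartan minEntryVal detVal; omega

/-- (K2) `λ = (1,0)` (`K diag(ϖ,1) K`): exactly the four cosets `(m,x,y) ∈ {(0,0,1), (0,1,0), (1,1,1), (−1,0,0)}`. -/
theorem inCartan_one_zero (m x y : ℤ) :
    InCartan 1 0 0 m x y ↔
      (m = 0 ∧ x = 0 ∧ y = 1) ∨ (m = 0 ∧ x = 1 ∧ y = 0) ∨ (m = 1 ∧ x = 1 ∧ y = 1) ∨
        (m = -1 ∧ x = 0 ∧ y = 0) := by
  unfold InCartan minEntryVal detVal; omega

/-- (K2) `λ = (1,1)` (`ϖ K`): the single coset `(0,1,1)`. -/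
theorem inCartan_one_one (m x y : ℤ) : InCartan 1 1 0 m x y ↔ m = 0 ∧ x = 1 ∧ y = 1 := by
  unfold InCartan minEntryVal detVal; omega

/-- (K2) `λ = (2,1)` (`ϖ · K diag(ϖ,1) K`): the four cosets `(0,1,2), (0,2,1), (1,2,2), (−1,1,1)`. -/
theorem inCartan_two_one (m x y : ℤ) :
    InCartan 2 1 0 m x y ↔
      (m = 0 ∧ x = 1 ∧ y = 2) ∨ (m = 0 ∧ x = 2 ∧ y = 1) ∨ (m = 1 ∧ x = 2 ∧ y = 2) ∨
        (m = -1 ∧ x = 1 ∧ y = 1) := by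
  unfold InCartan minEntryVal detVal; omega

/-- (K2) GENERAL `λ = (n,0)`, `n ≥ 0`: the cosets are `(m, m, n)`, `(m, n, m)` for `0 ≤ m ≤ n` and
`(m, 0, m+n)`, `(m, m+n, 0)` for `−n ≤ m < 0` — `4n` points when `n ≥ 1`. -/
theorem inCartan_n_zero (n : ℤ) (hn : 0 ≤ n) (m x y : ℤ) :
    InCartan n 0 0 m x y ↔
      (0 ≤ m ∧ m ≤ n ∧ ((x = m ∧ y = n) ∨ (x = n ∧ y = m))) ∨
        (-n ≤ m ∧ m < 0 ∧ ((x = 0 ∧ y = m + n) ∨ (x = m + n ∧ y = 0))) := by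
  unfold InCartan minEntryVal detVal; omega

/-- (K2) `λ = (2,0)` (`K diag(ϖ²,1) K`): the eight cosets
`(0,0,2), (0,2,0), (1,1,2), (1,2,1), (2,2,2), (−1,0,1), (−1,1,0), (−2,0,0)`. -/
theorem inCartan_two_zero (m x y : ℤ) :
    InCartan 2 0 0 m x y ↔
      (m = 0 ∧ x = 0 ∧ y = 2) ∨ (m = 0 ∧ x = 2 ∧ y = 0) ∨ (m = 1 ∧ x = 1 ∧ y = 2) ∨
        (m = 1 ∧ x = 2 ∧ y = 1) ∨ (m = 2 ∧ x = 2 ∧ y = 2) ∨ (m = -1 ∧ x = 0 ∧ y = 1) ∨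
          (m = -1 ∧ x = 1 ∧ y = 0) ∨ (m = -2 ∧ x = 0 ∧ y = 0) := by
  rw [inCartan_n_zero 2 (by norm_num)]
  constructor
  · rintro (⟨h0, h2, h⟩ | ⟨h0, h2, h⟩)
    · have hm : m = 0 ∨ m = 1 ∨ m = 2 := by omega
      rcases hm with rfl | rfl | rfl <;> rcases h with ⟨rfl, rfl⟩ | ⟨rfl, rfl⟩ <;> norm_num
    · have hm : m = -1 ∨ m = -2 := by omega
      rcases hm with rfl | rfl <;> rcases h with ⟨rfl, rfl⟩ | ⟨rfl, rfl⟩ <;> norm_num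
  · rintro (⟨rfl, rfl, rfl⟩ | ⟨rfl, rfl, rfl⟩ | ⟨rfl, rfl, rfl⟩ | ⟨rfl, rfl, rfl⟩ | ⟨rfl, rfl, rfl⟩ |
      ⟨rfl, rfl, rfl⟩ | ⟨rfl, rfl, rfl⟩ | ⟨rfl, rfl, rfl⟩) <;> norm_num

/-- The solution set of the model for `λ = (l₁, l₂)`, `u = 0` normalised: the `(m, x, y)` with
`t⁻¹ γ s ∈ K ϖ^λ K`. -/
def sol (l₁ l₂ : ℤ) : Set (ℤ × ℤ × ℤ) := {p | InCartan l₁ l₂ 0 p.1 p.2.1 p.2.2}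

/-- (K2) `sol 0 0 = {(0,0,0)}`. -/
theorem sol_zero_zero : sol 0 0 = {(0, 0, 0)} := by
  ext ⟨m, x, y⟩
  simp only [sol, Set.mem_setOf_eq, Set.mem_singleton_iff, Prod.mk.injEq, inCartan_zero_zero]

/-- (K2) `sol 1 0 = {(0,0,1), (0,1,0), (1,1,1), (−1,0,0)}`. -/
theorem sol_one_zero : sol 1 0 = {(0, 0, 1), (0, 1, 0), (1, 1, 1), (-1, 0, 0)} := by
  ext ⟨m, x, y⟩
  simp only [sol, Set.mem_setOf_eq, Set.mem_insert_iff, Set.mem_singleton_iff, Prod.mk.injEq,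
    inCartan_one_zero]

/-- (K2) `sol 1 1 = {(0,1,1)}`. -/
theorem sol_one_one : sol 1 1 = {(0, 1, 1)} := by
  ext ⟨m, x, y⟩
  simp only [sol, Set.mem_setOf_eq, Set.mem_singleton_iff, Prod.mk.injEq, inCartan_one_one]

/-- (K2) `sol 2 1 = {(0,1,2), (0,2,1), (1,2,2), (−1,1,1)}`. -/
theorem sol_two_one : sol 2 1 = {(0, 1, 2), (0, 2, 1), (1, 2, 2), (-1, 1, 1)} := by
  ext ⟨m, x, y⟩
  simp only [sol, Set.mem_setOf_eq, Set.mem_insert_iff, Set.mem_singleton_iff, Prod.mk.injEq,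
    inCartan_two_one]

/-- (K2) `sol 2 0` = the eight cosets `(0,0,2), (0,2,0), (1,1,2), (1,2,1), (2,2,2), (−1,0,1), (−1,1,0), (−2,0,0)`. -/
theorem sol_two_zero :
    sol 2 0 = {(0, 0, 2), (0, 2, 0), (1, 1, 2), (1, 2, 1), (2, 2, 2), (-1, 0, 1), (-1, 1, 0), (-2, 0, 0)} := by
  ext ⟨m, x, y⟩
  simp only [sol, Set.mem_setOf_eq, Set.mem_insert_iff, Set.mem_singleton_iff, Prod.mk.injEq,
    inCartan_two_zero]

/-- (K2) THE COUNTS: `1` coset for `λ = (0,0)`. -/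
theorem ncard_sol_zero_zero : (sol 0 0).ncard = 1 := by
  rw [sol_zero_zero, Set.ncard_singleton]

/-- (K2) THE COUNTS: `4` cosets for `λ = (1,0)` (`K diag(ϖ,1) K`). -/
theorem ncard_sol_one_zero : (sol 1 0).ncard = 4 := by
  rw [sol_one_zero, show ({(0, 0, 1), (0, 1, 0), (1, 1, 1), (-1, 0, 0)} : Set (ℤ × ℤ × ℤ)) =
      ↑({(0, 0, 1), (0, 1, 0), (1, 1, 1), (-1, 0, 0)} : Finset (ℤ × ℤ × ℤ)) by simp, Set.ncard_coe_finset]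
  decide

/-- (K2) THE COUNTS: `1` coset for `λ = (1,1)` (`ϖ K`). -/
theorem ncard_sol_one_one : (sol 1 1).ncard = 1 := by
  rw [sol_one_one, Set.ncard_singleton]

/-- (K2) THE COUNTS: `4` cosets for `λ = (2,1)`. -/
theorem ncard_sol_two_one : (sol 2 1).ncard = 4 := by
  rw [sol_two_one, show ({(0, 1, 2), (0, 2, 1), (1, 2, 2), (-1, 1, 1)} : Set (ℤ × ℤ × ℤ)) =
      ↑({(0, 1, 2), (0, 2, 1), (1, 2, 2), (-1, 1, 1)} : Finset (ℤ × ℤ × ℤ)) by simp, Set.ncard_coe_finset]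
  decide

/-- (K2) THE COUNTS: `8` cosets for `λ = (2,0)` (`K diag(ϖ²,1) K`) — `4n` at `n = 2`. -/
theorem ncard_sol_two_zero : (sol 2 0).ncard = 8 := by
  rw [sol_two_zero, show ({(0, 0, 2), (0, 2, 0), (1, 1, 2), (1, 2, 1), (2, 2, 2), (-1, 0, 1), (-1, 1, 0),
      (-2, 0, 0)} : Set (ℤ × ℤ × ℤ)) =
      ↑({(0, 0, 2), (0, 2, 0), (1, 1, 2), (1, 2, 1), (2, 2, 2), (-1, 0, 1), (-1, 1, 0), (-2, 0, 0)} :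
      Finset (ℤ × ℤ × ℤ)) by simp, Set.ncard_coe_finset]
  decide

end Summit.Ventures.HodgeRepro2.Tier7.Line3.HeckeWindow
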